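import Mathlib
import HarnessLib
import Literature.MathematicalPhysics.StatisticalMechanics.FluctuationKernelComparisonLocalTorusFRD
import Literature.MathematicalPhysics.StatisticalMechanics.TorusFRDKernelSecondDiffShell
import Literature.MathematicalPhysics.StatisticalMechanics.TorusFRDStepKernelConvex

/-!
# The FIRST-ORDER part of the `ℓ = 2` kernel comparison, volume-uniform per-polymer form:
# `‖fluct C̄ F − fluct 𝒞_{1+q+h,k+1} F‖_{k:k+1,X} ≤ b · ((r₀+1)·8q_H·h⁽²⁾_X) · κ^{|X|_k}`,
# `C̄ = ½(𝒞_{1+q,k+1} + 𝒞_{1+q+2h,k+1})`, `h⁽²⁾_X = O((Σ|h|)²)` ([ABKM19] Lemma 8.4 / Lemma 12.6, `ℓ = 2`)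

Along a line `q, q+h, q+2h` of tuning parameters the second difference of the Gaussian expectations splits as
`E_{C₂} − 2E_{C₁} + E_{C₀} = [E_{C₂} − 2E_{C̄} + E_{C₀}] + 2[E_{C̄} − E_{C₁}]` with the midpoint kernel
`C̄ = ½(C₀ + C₂)`.  This file bounds the second bracket — a FIRST-order comparison for the pair
`(C̄, C₁)` whose multipliers differ RELATIVELY by `ρ⁽²⁾_j(κ) = ½K⁽²⁾_j (Σ|h|)²` shell by shell
(`TorusFRDKernelSecondDiffShell`), square-summable over the shells of the SMALL torus
`(ℤ/L^{N̄})^d` carrying `X*⁺` exactly as in `tayNormLE_fluct_sub_fluct_local_of_torusFRD` — so the bound is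
quadratic in `Σ|h|` and uniform in the volume:

* `fourierCoeff_half_add`, `re_fourierCoeff_half_add` — multipliers of `½(𝒞₀ + 𝒞₂)`;
* **`tayNormLE_fluct_mid_sub_fluct_local_of_torusFRD`** — the statement above with
  `h⁽²⁾ = (3^{d+1} L^{(N̄−(k+1))d})^{1/2} · (½ (Σ|h|)² · K⁽²⁾)`, `K⁽²⁾ = shellRatioConst c (Cℓ 2) L d ñ`.

Everything is proved (transfer engine `tayNormLE_fluct_sub_fluct_of_sum_sq_transfer`, re-periodisation
`TorusKernelReperiodisation`, `StepKernelBounds` of convex combinations `TorusFRDStepKernelConvex`).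

## References
* S. Adams, S. Buchholz, R. Kotecký, S. Müller, arXiv:1910.13564, Lemma 8.4, Lemma 12.6
  [AdamsBuchholzKoteckyMuller2019].
* S. Buchholz, J. Funct. Anal. 275 (2018), Thm 2.4 / Thm 4.5 [Buchholz2016].
-/

noncomputable section

namespace Literature.MathematicalPhysics.StatisticalMechanics.GradientRG

open scoped BigOperators
open Real Set Finset MeasureTheory
open Literature.MathematicalPhysics.StatisticalMechanics.GradientFRD
  (fourierCoeff cExt cExt_of_mem IsElliptic IsUnitSymm InShell iterDiff supNorm conv ellOp isElliptic_one
    exists_inShell inShell_le re_fourierCoeff_zero_of_sum_eq_zero liftSite liftMode projSite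
    fourierCoeff_comp_liftSite_of_ne_zero fourierCoeff_comp_liftSite_zero inShell_liftMode_iff liftMode_eq_zero_iff
    comp_liftSite_even comp_liftSite_projSite_sub fourierCoeff_zero)
open Literature.MathematicalPhysics.StatisticalMechanics.TorusPolymer (IsPolymer numBlocks thicken)
open Literature.MathematicalPhysics.QuantumFieldTheory

variable {d M : ℕ} [NeZero M]

/-- The multipliers of the midpoint kernel `½(𝒞₀ + 𝒞₂)`. [cite: Buchholz2016, §2 (2.14)] -/
theorem fourierCoeff_half_add (𝒞₀ 𝒞₂ : (Fin d → ZMod M) → ℝ) (κ : Fin d → ZMod M) :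
    fourierCoeff (fun x => 2⁻¹ * 𝒞₀ x + 2⁻¹ * 𝒞₂ x) κ =
      ((2⁻¹ : ℝ) : ℂ) * fourierCoeff 𝒞₀ κ + ((2⁻¹ : ℝ) : ℂ) * fourierCoeff 𝒞₂ κ := by
  unfold GradientFRD.fourierCoeff
  rw [Finset.mul_sum, Finset.mul_sum, ← Finset.sum_add_distrib]
  refine Finset.sum_congr rfl fun x _ => ?_
  push_cast
  ring

/-- Real parts of the multipliers of the midpoint kernel. [cite: Buchholz2016, §2 (2.14)] -/
theorem re_fourierCoeff_half_add (𝒞₀ 𝒞₂ : (Fin d → ZMod M) → ℝ) (κ : Fin d → ZMod M) :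
    (fourierCoeff (fun x => 2⁻¹ * 𝒞₀ x + 2⁻¹ * 𝒞₂ x) κ).re =
      2⁻¹ * (fourierCoeff 𝒞₀ κ).re + 2⁻¹ * (fourierCoeff 𝒞₂ κ).re := by
  rw [fourierCoeff_half_add, Complex.add_re, Complex.re_ofReal_mul, Complex.re_ofReal_mul]

section Package

variable {L N Mord R n ñ : ℕ} {θbar lam μ δ₁ δ₀ A𝒫 : ℝ}
    {𝒞 : Matrix (Fin d) (Fin d) ℝ → ℕ → (Fin d → ZMod M) → ℝ} {Mc : ℕ → ℝ}
    {Cα : (Fin d → ℕ) → ℕ → ℝ} {c C : ℝ} {Cℓ : ℕ → ℝ}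

set_option maxHeartbeats 3200000 in
/-- **First-order part of the `ℓ = 2` comparison, volume-uniform per-polymer form**: for one `TorusFRD`
package with the gap `d + 1 ≤ 2(ñ−n)` on `(ℤ/L^N)^d`, symmetric `q`, `h` with `q, q+h, q+2h` in the ball
`Σ|·| ≤ T₀` (`T₀ ≤ ½`, `K T₀ ≤ log(1+ρ)`, `ρ < θ̄`), Hölder conjugates `p, q_H` with `p(1+ρ) ≤ 1+ρ''`
(`ρ'' < θ̄`), a `k`-polymer `X` with `k+1 ≤ N̄ ≤ N` and `diam_∞(X*⁺) ≤ L^{N̄}/2`, a `T_k^{X*}`-local `C^{r₀}`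
functional `F` with `‖F‖_{k,X} ≤ b`, and the midpoint kernel `C̄ = ½(𝒞_{1+q,k+1} + 𝒞_{1+q+2h,k+1})`:
`‖fluct C̄ F − fluct 𝒞_{1+q+h,k+1} F‖_{k:k+1,X} ≤ b·((r₀+1)·8q_H·h⁽²⁾)·κ^{|X|_k}`,
`h⁽²⁾ = (3^{d+1} L^{(N̄−(k+1))d})^{1/2} · (½(Σ|h|)²·K⁽²⁾)`, `K⁽²⁾ = shellRatioConst c (Cℓ 2) L d ñ`.
[cite: AdamsBuchholzKoteckyMuller2019, Lemma 8.4 / Lemma 12.6] -/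
theorem tayNormLE_fluct_mid_sub_fluct_local_of_torusFRD
    (hd : 3 ≤ d) (hMord : 1 ≤ Mord) (hMR : Mord ≤ R) (hLodd : Odd L) (hL : 2 ^ (d + 3) + 16 * R ≤ L) (hM : M = L ^ N)
    (hθbar : 0 < θbar) (hlam : 0 < lam) (hn : 2 * Mord ≤ n) (hn2 : 2 ≤ n) (hnñ : n ≤ ñ)
    (hgap : d + 1 ≤ 2 * (ñ - n))
    (hc : 0 < c) (hC1 : 0 ≤ Cℓ 1) (hC2 : 0 ≤ Cℓ 2)
    (hallA : ∀ A : Matrix (Fin d) (Fin d) ℝ, IsElliptic (1 / 2 : ℝ) 2 A →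
        (∀ k, 1 ≤ k → k ≤ N + 1 →
          ∑ x : Fin d → ZMod M, 𝒞 A k x = 0 ∧ ∀ x, 𝒞 A k (-x) = 𝒞 A k x) ∧
        (∀ k, 1 ≤ k → k ≤ N + 1 → ∀ φ : (Fin d → ZMod M) → ℝ, ∑ x, φ x = 0 →
          0 ≤ ∑ x, ∑ y, φ x * 𝒞 A k (x - y) * φ y) ∧
        (∀ φ : (Fin d → ZMod M) → ℝ, ∑ x, φ x = 0 →
          ellOp A (conv (fun x => ∑ k ∈ Finset.Icc 1 (N + 1), 𝒞 A k x) φ) = φ) ∧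
        (∀ k, 1 ≤ k → k ≤ N → Mc k ≤ 0 ∧
          ∀ x : Fin d → ZMod M, ((L : ℝ) ^ k) / 2 ≤ (supNorm x : ℝ) →
            𝒞 A k x = Mc k) ∧
        (∀ k, 1 ≤ k → k ≤ N + 1 → ∀ B : Matrix (Fin d) (Fin d) ℝ, IsUnitSymm B →
          (∃ ε : ℝ, 0 < ε ∧ ∀ x : Fin d → ZMod M,
            ContDiffOn ℝ ⊤ (fun s : ℝ => 𝒞 (A + s • B) k x) (Set.Ioo (-ε) ε)) ∧
          ∀ α : Fin d → ℕ, ∑ i, α i ≤ n → ∀ ℓ : ℕ, ∀ x : Fin d → ZMod M,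
            abs (iteratedDeriv ℓ (fun s : ℝ => iterDiff α (𝒞 (A + s • B) k) x) 0)
              ≤ Cα α ℓ / (L : ℝ) ^ ((k - 1) * (d - 2 + ∑ i, α i))) ∧
        (∀ k, 1 ≤ k → k ≤ N + 1 → ∀ j : ℕ, ∀ κ : Fin d → ZMod M, κ ≠ 0 → InShell L j κ →
          (j < k →
            c / (L : ℝ) ^ (2 * (d + ñ) + 1) * (L : ℝ) ^ (2 * j)
                / (L : ℝ) ^ ((k - j) * (d - 1 + n)) ≤ (fourierCoeff (𝒞 A k) κ).re ∧
            ‖fourierCoeff (𝒞 A k) κ‖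
              ≤ C * (L : ℝ) ^ (2 * (d + ñ) + 1) * (L : ℝ) ^ (2 * j)
                  / (L : ℝ) ^ ((k - j) * (d - 1 + n))) ∧
          (k ≤ j →
            c / (L : ℝ) ^ (2 * (d + ñ) + 1) * (L : ℝ) ^ (2 * k)
                ≤ (fourierCoeff (𝒞 A k) κ).re ∧
            ‖fourierCoeff (𝒞 A k) κ‖ ≤ C * (L : ℝ) ^ (2 * k)) ∧
          ∀ B : Matrix (Fin d) (Fin d) ℝ, IsUnitSymm B → ∀ ℓ : ℕ, 1 ≤ ℓ →
            (j < k →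
              ‖iteratedDeriv ℓ (fun s : ℝ => fourierCoeff (𝒞 (A + s • B) k) κ) 0‖
                ≤ Cℓ ℓ * (L : ℝ) ^ (2 * (d + ñ) + 1) * (L : ℝ) ^ (2 * j)
                    / (L : ℝ) ^ ((k - j) * (d - 1 + ñ))) ∧
            (k ≤ j →
              ‖iteratedDeriv ℓ (fun s : ℝ => fourierCoeff (𝒞 (A + s • B) k) κ) 0‖
                ≤ Cℓ ℓ * (L : ℝ) ^ (2 * k))))
    (hB : AbkmWeightBounds L N Mord R n θbar lam μ δ₁ δ₀ A𝒫 (fun j => 𝒞 1 j)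
      (abkmWeightData L N Mord R θbar (schedDelta δ₀ δ₁ N) fun j => 𝒞 1 j))
    {k : ℕ} {ρ : ℝ} (hρ0 : 0 ≤ ρ) (hρ : ρ < θbar)
    {T₀ : ℝ} (hT₀ : T₀ ≤ 1 / 2) (hKT₀ : shellRatioConst c (Cℓ 1) (L : ℝ) d ñ * T₀ ≤ Real.log (1 + ρ))
    {q y : Matrix (Fin d) (Fin d) ℝ} (hq : q.IsSymm) (hh : y.IsSymm)
    (hqT : ∑ i, ∑ j, |q i j| ≤ T₀) (hqhT : ∑ i, ∑ j, |(q + y) i j| ≤ T₀)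
    (hq2hT : ∑ i, ∑ j, |(q + (2 : ℝ) • y) i j| ≤ T₀)
    {p qH ρ'' : ℝ} (hpq : p.HolderConjugate qH) (hρ''0 : 0 ≤ ρ'') (hρ'' : ρ'' < θbar)
    (hpρ : p * (1 + ρ) ≤ 1 + ρ'')
    {pT r₀ : ℕ} {h A : ℝ} {X : Finset (Fin d → ZMod M)} (hX : IsPolymer (L ^ k) X)
    {Nb : ℕ} (hNbk : k + 1 ≤ Nb) (hNbN : Nb ≤ N)
    (hdiam : ∀ x ∈ thicken pT (thicken (starRad R L d k) X), ∀ y ∈ thicken pT (thicken (starRad R L d k) X),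
      supNorm (x - y) ≤ L ^ Nb / 2)
    {F : ((Fin d → ZMod M) → ℝ) → ℂ} {b : ℝ} (hb : 0 ≤ b) (hFd : ContDiff ℝ r₀ F)
    (hFloc : IsGaugeLocal ((abkmNormParams L N Mord R pT r₀ h θbar A (schedDelta δ₀ δ₁ N)
      fun j => 𝒞 1 j).gauge k X) F)
    (hF : TayNormLE ((abkmNormParams L N Mord R pT r₀ h θbar A (schedDelta δ₀ δ₁ N) fun j => 𝒞 1 j).gauge k X)
      r₀ ((abkmWeightData L N Mord R θbar (schedDelta δ₀ δ₁ N) fun j => 𝒞 1 j).weight k X) F b) :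
    TayNormLE ((abkmNormParams L N Mord R pT r₀ h θbar A (schedDelta δ₀ δ₁ N) fun j => 𝒞 1 j).gauge k X) r₀
      ((abkmWeightData L N Mord R θbar (schedDelta δ₀ δ₁ N) fun j => 𝒞 1 j).midWeight k X)
      (fluct (fun x => 2⁻¹ * 𝒞 ((1 : Matrix (Fin d) (Fin d) ℝ) + q) (k + 1) x +
          2⁻¹ * 𝒞 ((1 : Matrix (Fin d) (Fin d) ℝ) + (q + (2 : ℝ) • y)) (k + 1) x) F -
        fluct (𝒞 ((1 : Matrix (Fin d) (Fin d) ℝ) + (q + y)) (k + 1)) F)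
      (b * ((r₀ + 1) * (8 * qH *
          (Real.sqrt ((3 : ℝ) ^ (d + 1) * (L : ℝ) ^ ((Nb - (k + 1)) * d)) *
            (2⁻¹ * (∑ i, ∑ j, |y i j|) ^ 2 * shellRatioConst c (Cℓ 2) (L : ℝ) d ñ)))) *
        (weightIntConstRho θbar ρ'' (traceConst d Mord R lam (derivSum d n fun θ' _ => Cα θ' 0)) ^ (1 / p)) ^
          numBlocks (L ^ k) X) := by
  have hk : k + 1 ≤ N + 1 := by omega
  have hkN : k + 1 ≤ N := le_trans hNbk hNbN
  have h8 : 8 ≤ 2 ^ (d + 3) := by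
    calc 8 = 2 ^ 3 := by norm_num
      _ ≤ 2 ^ (d + 3) := Nat.pow_le_pow_right (by norm_num) (by omega)
  have hL2 : 2 ≤ L := by omega
  have hL5 : 5 ≤ L := by omega
  have hL1 : 1 ≤ L := by omega
  have hd1 : 1 ≤ d := by omega
  have hd2 : 2 ≤ d := by omega
  have hL0 : (0 : ℝ) ≤ (L : ℝ) := Nat.cast_nonneg _
  have hL1r : (1 : ℝ) ≤ (L : ℝ) := by exact_mod_cast hL1
  have hLpos : (0 : ℝ) < (L : ℝ) := by linarith
  have hp0 : 0 ≤ p := by linarith [hpq.lt]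
  -- the three points
  have hqh : (q + y).IsSymm := hq.add hh
  have hq2h : (q + (2 : ℝ) • y).IsSymm := hq.add (hh.smul _)
  have hq2 : ∑ i, ∑ j, |q i j| ≤ 1 / 2 := hqT.trans hT₀
  have hqh2 : ∑ i, ∑ j, |(q + y) i j| ≤ 1 / 2 := hqhT.trans hT₀
  have hq2h2 : ∑ i, ∑ j, |(q + (2 : ℝ) • y) i j| ≤ 1 / 2 := hq2hT.trans hT₀
  have hell₀ : IsElliptic (1 / 2 : ℝ) 2 ((1 : Matrix (Fin d) (Fin d) ℝ) + q) :=
    isElliptic_one_add_of_entrySum_le hq hq2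
  have hell₁ : IsElliptic (1 / 2 : ℝ) 2 ((1 : Matrix (Fin d) (Fin d) ℝ) + (q + y)) :=
    isElliptic_one_add_of_entrySum_le hqh hqh2
  have hell₂ : IsElliptic (1 / 2 : ℝ) 2 ((1 : Matrix (Fin d) (Fin d) ℝ) + (q + (2 : ℝ) • y)) :=
    isElliptic_one_add_of_entrySum_le hq2h hq2h2
  -- the small torus `(ℤ/L^N̄)^d`
  set Mb : ℕ := L ^ Nb with hMbdef
  haveI : NeZero Mb := ⟨pow_ne_zero _ (by omega)⟩
  set r : ℕ := L ^ (N - Nb) with hrdef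
  have hr1 : 1 ≤ r := Nat.one_le_pow _ _ (by omega)
  have hMr : M = r * Mb := by
    rw [hM, hrdef, hMbdef, ← pow_add, Nat.sub_add_cancel hNbN]
  have hMbodd : Odd Mb := by rw [hMbdef]; exact hLodd.pow
  have hdvd : Mb ∣ M := ⟨r, by rw [hMr, mul_comm]⟩
  have hMble : Mb ≤ M := Nat.le_of_dvd (Nat.pos_of_ne_zero (NeZero.ne M)) hdvd
  -- constants
  set K2 := shellRatioConst c (Cℓ 2) (L : ℝ) d ñ with hK2def
  have hK20 : 0 ≤ K2 := shellRatioConst_nonneg hc hC2 hL0 d ñ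
  set T := ∑ i, ∑ j, |y i j| with hTdef
  have hT0 : 0 ≤ T := sum_nonneg fun _ _ => sum_nonneg fun _ _ => abs_nonneg _
  set E := 2⁻¹ * T ^ 2 with hEdef
  have hE0 : 0 ≤ E := by positivity
  set Kj : ℕ → ℝ := fun j => K2 / (L : ℝ) ^ ((k + 1 - j) * (ñ - n)) with hKjdef
  have hKj0 : ∀ j, 0 ≤ Kj j := fun j => by positivity
  -- big-torus kernel data: `𝒞₀, 𝒞₁, 𝒞₂`, the midpoint `𝒞a = ½(𝒞₀ + 𝒞₂)` and `𝒞b = 𝒞₁`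
  set 𝒞₀ : (Fin d → ZMod M) → ℝ := 𝒞 ((1 : Matrix (Fin d) (Fin d) ℝ) + q) (k + 1) with h𝒞₀
  set 𝒞₁ : (Fin d → ZMod M) → ℝ := 𝒞 ((1 : Matrix (Fin d) (Fin d) ℝ) + (q + y)) (k + 1) with h𝒞₁
  set 𝒞₂ : (Fin d → ZMod M) → ℝ := 𝒞 ((1 : Matrix (Fin d) (Fin d) ℝ) + (q + (2 : ℝ) • y)) (k + 1) with h𝒞₂
  set 𝒞a : (Fin d → ZMod M) → ℝ := fun x => 2⁻¹ * 𝒞₀ x + 2⁻¹ * 𝒞₂ x with h𝒞a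
  have hA𝒫p : 0 ≤ weightIntConstRho θbar ρ'' (traceConst d Mord R lam (derivSum d n fun θ' _ => Cα θ' 0)) :=
    zero_le_one.trans (one_le_weightIntConstRho hθbar hρ''0 hρ''
      (traceConst_nonneg d Mord R hlam.le (derivSum_nonneg d n _)))
  -- `StepKernelBounds` for `𝒞a`, `𝒞b` and the segment between them (convex combinations)
  have h1ρ : (1 : ℝ) * (1 + ρ) ≤ 1 + ρ := by rw [one_mul]
  have hSa : StepKernelBounds (abkmWeightData L N Mord R θbar (schedDelta δ₀ δ₁ N) fun j => 𝒞 1 j) L k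
      (weightIntConstRho θbar ρ (traceConst d Mord R lam (derivSum d n fun θ' _ => Cα θ' 0)))
      (secondDiffConst fun θ' => Cα θ' 0) 𝒞a := by
    have h1 := stepKernelBounds_const_mul_convex3_of_torusFRD hd hMord hMR hLodd hL hθbar hlam hn hn2 hnñ hc hC1
      hallA hB hk hρ0 hT₀ hKT₀ hq hqh hq2h hqT hqhT hq2hT (p := 1) zero_le_one hρ0 hρ h1ρ
      (a := 2⁻¹) (b := 0) (c₃ := 2⁻¹) (by norm_num) le_rfl (by norm_num) (by norm_num)
    have e : (fun x => (1 : ℝ) * (2⁻¹ * 𝒞 ((1 : Matrix (Fin d) (Fin d) ℝ) + q) (k + 1) x +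
        0 * 𝒞 ((1 : Matrix (Fin d) (Fin d) ℝ) + (q + y)) (k + 1) x +
        2⁻¹ * 𝒞 ((1 : Matrix (Fin d) (Fin d) ℝ) + (q + (2 : ℝ) • y)) (k + 1) x)) = 𝒞a := by
      funext x; simp only [h𝒞a, h𝒞₀, h𝒞₂]; ring
    rw [e, one_mul] at h1
    exact h1
  have hSb : StepKernelBounds (abkmWeightData L N Mord R θbar (schedDelta δ₀ δ₁ N) fun j => 𝒞 1 j) L k
      (weightIntConstRho θbar ρ (traceConst d Mord R lam (derivSum d n fun θ' _ => Cα θ' 0)))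
      (secondDiffConst fun θ' => Cα θ' 0) 𝒞₁ :=
    stepKernelBounds_one_add_of_torusFRD hd hMord hMR hLodd hL hθbar hlam hn hn2 hnñ hc hC1 hallA hB hk
      hρ0 hρ hT₀ hKT₀ hqh hqhT
  have hSp : ∀ t ∈ Set.Icc (0 : ℝ) 1,
      StepKernelBounds (abkmWeightData L N Mord R θbar (schedDelta δ₀ δ₁ N) fun j => 𝒞 1 j) L k
        (weightIntConstRho θbar ρ'' (traceConst d Mord R lam (derivSum d n fun θ' _ => Cα θ' 0)))
        (p * secondDiffConst fun θ' => Cα θ' 0)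
        (fun x => p * (𝒞₁ x + t * (𝒞a x - 𝒞₁ x))) := by
    intro t ht
    have h1 := stepKernelBounds_const_mul_convex3_of_torusFRD hd hMord hMR hLodd hL hθbar hlam hn hn2 hnñ hc hC1
      hallA hB hk hρ0 hT₀ hKT₀ hq hqh hq2h hqT hqhT hq2hT hp0 hρ''0 hρ'' hpρ
      (a := t / 2) (b := 1 - t) (c₃ := t / 2) (by linarith [ht.1]) (by linarith [ht.2]) (by linarith [ht.1])
      (by ring)
    have e : (fun x => p * (t / 2 * 𝒞 ((1 : Matrix (Fin d) (Fin d) ℝ) + q) (k + 1) x +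
        (1 - t) * 𝒞 ((1 : Matrix (Fin d) (Fin d) ℝ) + (q + y)) (k + 1) x +
        t / 2 * 𝒞 ((1 : Matrix (Fin d) (Fin d) ℝ) + (q + (2 : ℝ) • y)) (k + 1) x)) =
        fun x => p * (𝒞₁ x + t * (𝒞a x - 𝒞₁ x)) := by
      funext x; simp only [h𝒞a, h𝒞₀, h𝒞₁, h𝒞₂]; ring
    rw [e] at h1
    exact h1
  -- evenness, zero sums, positivity
  have ho₀ := (hallA _ hell₀).1 (k + 1) (by omega) hk
  have ho₁ := (hallA _ hell₁).1 (k + 1) (by omega) hk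
  have ho₂ := (hallA _ hell₂).1 (k + 1) (by omega) hk
  have hea : ∀ x, 𝒞a (-x) = 𝒞a x := fun x => by simp only [h𝒞a, h𝒞₀, h𝒞₂, ho₀.2 x, ho₂.2 x]
  have heb : ∀ x, 𝒞₁ (-x) = 𝒞₁ x := ho₁.2
  have h0a : ∑ x, 𝒞a x = 0 := by
    simp only [h𝒞a, h𝒞₀, h𝒞₂, Finset.sum_add_distrib, ← Finset.mul_sum, ho₀.1, ho₂.1, mul_zero, add_zero]
  have h0b : ∑ x, 𝒞₁ x = 0 := ho₁.1
  have hpos₀ : ∀ κ : Fin d → ZMod M, κ ≠ 0 → 0 < (fourierCoeff 𝒞₀ κ).re := fun κ hκ =>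
    re_fourierCoeff_pos_of_torusFRD (hallA _ hell₀).2.2.2.2.2 hc hL2 (by omega) hk hκ
  have hpos₁ : ∀ κ : Fin d → ZMod M, κ ≠ 0 → 0 < (fourierCoeff 𝒞₁ κ).re := fun κ hκ =>
    re_fourierCoeff_pos_of_torusFRD (hallA _ hell₁).2.2.2.2.2 hc hL2 (by omega) hk hκ
  have hpos₂ : ∀ κ : Fin d → ZMod M, κ ≠ 0 → 0 < (fourierCoeff 𝒞₂ κ).re := fun κ hκ =>
    re_fourierCoeff_pos_of_torusFRD (hallA _ hell₂).2.2.2.2.2 hc hL2 (by omega) hk hκ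
  have hposa : ∀ κ : Fin d → ZMod M, κ ≠ 0 → 0 < (fourierCoeff 𝒞a κ).re := fun κ hκ => by
    rw [h𝒞a, re_fourierCoeff_half_add]
    exact add_pos (mul_pos (by norm_num) (hpos₀ κ hκ)) (mul_pos (by norm_num) (hpos₂ κ hκ))
  -- finite range: all kernels are the constant `M_{k+1}` beyond sup-norm `L^{N̄}/2`
  have hfin := fun (A' : Matrix (Fin d) (Fin d) ℝ) (hA' : IsElliptic (1 / 2 : ℝ) 2 A') =>
    (hallA A' hA').2.2.2.1 (k + 1) (by omega) hkN
  have hMc : Mc (k + 1) ≤ 0 := (hfin _ hell₀).1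
  have hfar : ∀ (A' : Matrix (Fin d) (Fin d) ℝ), IsElliptic (1 / 2 : ℝ) 2 A' →
      ∀ x : Fin d → ZMod M, Mb / 2 < supNorm x → 𝒞 A' (k + 1) x = Mc (k + 1) := by
    intro A' hA' x hx
    refine (hfin A' hA').2 x ?_
    have h1 : (L : ℝ) ^ (k + 1) ≤ (L : ℝ) ^ Nb := pow_le_pow_right₀ hL1r hNbk
    have h2 : ((Mb / 2 : ℕ) : ℝ) + 1 ≤ (supNorm x : ℝ) := by exact_mod_cast hx
    have h3 : ((L : ℝ) ^ Nb) / 2 ≤ ((Mb / 2 : ℕ) : ℝ) + 1 := by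
      have : ((Mb / 2 : ℕ) : ℝ) ≥ (Mb : ℝ) / 2 - 1 := by
        have h4 : (Mb : ℝ) ≤ 2 * ((Mb / 2 : ℕ) : ℝ) + 1 := by exact_mod_cast (by omega : Mb ≤ 2 * (Mb / 2) + 1)
        linarith
      have hMbr : (Mb : ℝ) = (L : ℝ) ^ Nb := by rw [hMbdef]; push_cast; rfl
      linarith
    linarith
  have hfara : ∀ x : Fin d → ZMod M, Mb / 2 < supNorm x → 𝒞a x = Mc (k + 1) := by
    intro x hx
    simp only [h𝒞a, h𝒞₀, h𝒞₂, hfar _ hell₀ x hx, hfar _ hell₂ x hx]; ring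
  have hfarb : ∀ x : Fin d → ZMod M, Mb / 2 < supNorm x → 𝒞₁ x = Mc (k + 1) := fun x hx => hfar _ hell₁ x hx
  -- the re-periodised kernels on the small torus
  set 𝒞a' : (Fin d → ZMod Mb) → ℝ := fun z => 𝒞a (liftSite M z) with h𝒞a'
  set 𝒞b' : (Fin d → ZMod Mb) → ℝ := fun z => 𝒞₁ (liftSite M z) with h𝒞b'
  have hea' : ∀ z, 𝒞a' (-z) = 𝒞a' z := fun z => comp_liftSite_even hMbodd hea z
  have heb' : ∀ z, 𝒞b' (-z) = 𝒞b' z := fun z => comp_liftSite_even hMbodd heb z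
  have hfa_ne : ∀ κ : Fin d → ZMod Mb, κ ≠ 0 → fourierCoeff 𝒞a' κ = fourierCoeff 𝒞a (liftMode M r κ) :=
    fun κ hκ => fourierCoeff_comp_liftSite_of_ne_zero hr1 hMr hMbodd hfara hκ
  have hfb_ne : ∀ κ : Fin d → ZMod Mb, κ ≠ 0 → fourierCoeff 𝒞b' κ = fourierCoeff 𝒞₁ (liftMode M r κ) :=
    fun κ hκ => fourierCoeff_comp_liftSite_of_ne_zero hr1 hMr hMbodd hfarb hκ
  have hfa_zero : (fourierCoeff 𝒞a' 0).re = -(Mc (k + 1)) * ((M : ℝ) ^ d - (Mb : ℝ) ^ d) := by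
    have h := fourierCoeff_comp_liftSite_zero hr1 hMr hMbodd hfara (𝒞 := 𝒞a)
    have h2 : fourierCoeff 𝒞a' 0 = ((-(Mc (k + 1)) * ((M : ℝ) ^ d - (Mb : ℝ) ^ d) : ℝ) : ℂ) := by
      rw [h, fourierCoeff_zero, h0a]; push_cast; ring
    rw [h2, Complex.ofReal_re]
  have hfb_zero : (fourierCoeff 𝒞b' 0).re = -(Mc (k + 1)) * ((M : ℝ) ^ d - (Mb : ℝ) ^ d) := by
    have h := fourierCoeff_comp_liftSite_zero hr1 hMr hMbodd hfarb (𝒞 := 𝒞₁)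
    have h2 : fourierCoeff 𝒞b' 0 = ((-(Mc (k + 1)) * ((M : ℝ) ^ d - (Mb : ℝ) ^ d) : ℝ) : ℂ) := by
      rw [h, fourierCoeff_zero, h0b]; push_cast; ring
    rw [h2, Complex.ofReal_re]
  have hzero_nn : 0 ≤ -(Mc (k + 1)) * ((M : ℝ) ^ d - (Mb : ℝ) ^ d) := by
    refine mul_nonneg (by linarith) ?_
    have : (Mb : ℝ) ^ d ≤ (M : ℝ) ^ d := pow_le_pow_left₀ (Nat.cast_nonneg _) (by exact_mod_cast hMble) d
    linarith
  have hposa' : ∀ κ : Fin d → ZMod Mb, κ ≠ 0 → 0 < (fourierCoeff 𝒞a' κ).re := by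
    intro κ hκ
    rw [hfa_ne κ hκ]
    exact hposa _ (fun h0 => hκ ((liftMode_eq_zero_iff hr1 hMr κ).1 h0))
  have hposb' : ∀ κ : Fin d → ZMod Mb, κ ≠ 0 → 0 < (fourierCoeff 𝒞b' κ).re := by
    intro κ hκ
    rw [hfb_ne κ hκ]
    exact hpos₁ _ (fun h0 => hκ ((liftMode_eq_zero_iff hr1 hMr κ).1 h0))
  have hnna' : ∀ κ : Fin d → ZMod Mb, 0 ≤ (fourierCoeff 𝒞a' κ).re := by
    intro κ
    by_cases hκ : κ = 0
    · rw [hκ, hfa_zero]; exact hzero_nn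
    · exact (hposa' κ hκ).le
  have hnnb' : ∀ κ : Fin d → ZMod Mb, 0 ≤ (fourierCoeff 𝒞b' κ).re := by
    intro κ
    by_cases hκ : κ = 0
    · rw [hκ, hfb_zero]; exact hzero_nn
    · exact (hposb' κ hκ).le
  -- the support of the gauge and the covariance identity
  set S := thicken pT (thicken (starRad R L d k) X) with hSdef
  have hcova : ∀ x ∈ S, ∀ y ∈ S, 𝒞a' (projSite hdvd x - projSite hdvd y) = 𝒞a (x - y) :=
    fun x hx y hy => comp_liftSite_projSite_sub hdvd hMbodd 𝒞a (hdiam x hx y hy)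
  have hcovb : ∀ x ∈ S, ∀ y ∈ S, 𝒞b' (projSite hdvd x - projSite hdvd y) = 𝒞₁ (x - y) :=
    fun x hx y hy => comp_liftSite_projSite_sub hdvd hMbodd 𝒞₁ (hdiam x hx y hy)
  have hTloc : ∀ ζ ζ' : (Fin d → ZMod M) → ℝ, (∀ x ∈ S, ζ x = ζ' x) →
      (abkmNormParams L N Mord R pT r₀ h θbar A (schedDelta δ₀ δ₁ N) fun j => 𝒞 1 j).gauge k X ζ =
        (abkmNormParams L N Mord R pT r₀ h θbar A (schedDelta δ₀ δ₁ N) fun j => 𝒞 1 j).gauge k X ζ' :=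
    fun ζ ζ' hζ => fieldGauge_eq_of_eqOn_thicken hζ
  -- the mode-wise relative bound on the small torus: `ρ⁽²⁾_j = ½ K⁽²⁾_j T²`
  classical
  set ρm : (Fin d → ZMod Mb) → ℝ := fun κ =>
    if hκ : κ = 0 then 0 else 2⁻¹ * (Kj (Classical.choose (exists_inShell hL2 hκ)) * T ^ 2) with hρmdef
  have hρm_nonneg : ∀ κ, 0 ≤ ρm κ := by
    intro κ
    simp only [hρmdef]
    split_ifs
    · exact le_rfl
    · exact mul_nonneg (by norm_num) (mul_nonneg (hKj0 _) (sq_nonneg _))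
  have hρm0 : ρm 0 = 0 := by simp only [hρmdef, dif_pos]
  have hshell : ∀ (κ : Fin d → ZMod Mb) (hκ : κ ≠ 0),
      |(fourierCoeff 𝒞a' κ).re - (fourierCoeff 𝒞b' κ).re| ≤ ρm κ * (fourierCoeff 𝒞a' κ).re ∧
        |(fourierCoeff 𝒞a' κ).re - (fourierCoeff 𝒞b' κ).re| ≤ ρm κ * (fourierCoeff 𝒞b' κ).re := by
    intro κ hκ
    have hj := Classical.choose_spec (exists_inShell hL2 hκ)
    set j := Classical.choose (exists_inShell hL2 hκ) with hjdef
    have hj' : InShell L j (liftMode M r κ) := (inShell_liftMode_iff hr1 hMr L _ κ).2 hj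
    have hκ' : liftMode M r κ ≠ 0 := fun h0 => hκ ((liftMode_eq_zero_iff hr1 hMr κ).1 h0)
    have hcmp := fun (p' : Matrix (Fin d) (Fin d) ℝ) (hp' : p' = q ∨ p' = q + y ∨ p' = q + (2 : ℝ) • y) =>
      norm_fourierCoeff_one_add_line_secondDiff_le_shell_of_torusFRD (fun A hA => (hallA A hA).2.2.2.2.1)
        (fun A hA => (hallA A hA).2.2.2.2.2) hc hC2 hL1 hnñ hq hh hq2 hq2h2 (k := k + 1) (by omega) hk hκ' hj' hp'
    have hρκ : ρm κ = 2⁻¹ * (Kj j * T ^ 2) := by simp only [hρmdef, dif_neg hκ, hjdef]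
    -- the difference of the real parts is half the real part of the second difference
    set Δ : ℂ := fourierCoeff 𝒞₂ (liftMode M r κ) - 2 * fourierCoeff 𝒞₁ (liftMode M r κ) +
      fourierCoeff 𝒞₀ (liftMode M r κ) with hΔ
    have hdiff : (fourierCoeff 𝒞a' κ).re - (fourierCoeff 𝒞b' κ).re = 2⁻¹ * Δ.re := by
      rw [hfa_ne κ hκ, hfb_ne κ hκ, h𝒞a, re_fourierCoeff_half_add, hΔ]
      simp only [Complex.add_re, Complex.sub_re, Complex.mul_re, Complex.re_ofNat, Complex.im_ofNat, zero_mul,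
        sub_zero]
      ring
    have hΔle : ∀ (p' : Matrix (Fin d) (Fin d) ℝ), (p' = q ∨ p' = q + y ∨ p' = q + (2 : ℝ) • y) →
        |(fourierCoeff 𝒞a' κ).re - (fourierCoeff 𝒞b' κ).re| ≤
          ρm κ * (fourierCoeff (𝒞 ((1 : Matrix (Fin d) (Fin d) ℝ) + p') (k + 1)) (liftMode M r κ)).re := by
      intro p' hp'
      rw [hdiff, hρκ, abs_mul, abs_of_pos (by norm_num : (0 : ℝ) < 2⁻¹), mul_assoc]
      refine mul_le_mul_of_nonneg_left ((Complex.abs_re_le_norm Δ).trans ?_) (by norm_num)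
      have h1 := hcmp p' hp'
      rw [hKjdef]
      exact h1
    rw [hρκ]
    rw [hρκ] at hΔle
    have h₀ : |(fourierCoeff 𝒞a' κ).re - (fourierCoeff 𝒞b' κ).re| ≤
        2⁻¹ * (Kj j * T ^ 2) * (fourierCoeff 𝒞₀ (liftMode M r κ)).re := hΔle q (Or.inl rfl)
    have h₁ : |(fourierCoeff 𝒞a' κ).re - (fourierCoeff 𝒞b' κ).re| ≤
        2⁻¹ * (Kj j * T ^ 2) * (fourierCoeff 𝒞₁ (liftMode M r κ)).re := hΔle (q + y) (Or.inr (Or.inl rfl))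
    have h₂ : |(fourierCoeff 𝒞a' κ).re - (fourierCoeff 𝒞b' κ).re| ≤
        2⁻¹ * (Kj j * T ^ 2) * (fourierCoeff 𝒞₂ (liftMode M r κ)).re :=
      hΔle (q + (2 : ℝ) • y) (Or.inr (Or.inr rfl))
    have eA : (fourierCoeff 𝒞a' κ).re =
        2⁻¹ * (fourierCoeff 𝒞₀ (liftMode M r κ)).re + 2⁻¹ * (fourierCoeff 𝒞₂ (liftMode M r κ)).re := by
      rw [hfa_ne κ hκ, h𝒞a, re_fourierCoeff_half_add]
    have eB : (fourierCoeff 𝒞b' κ).re = (fourierCoeff 𝒞₁ (liftMode M r κ)).re := by rw [hfb_ne κ hκ]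
    refine ⟨?_, ?_⟩
    · calc |(fourierCoeff 𝒞a' κ).re - (fourierCoeff 𝒞b' κ).re|
          ≤ 2⁻¹ * (2⁻¹ * (Kj j * T ^ 2) * (fourierCoeff 𝒞₀ (liftMode M r κ)).re) +
              2⁻¹ * (2⁻¹ * (Kj j * T ^ 2) * (fourierCoeff 𝒞₂ (liftMode M r κ)).re) := by linarith
        _ = 2⁻¹ * (Kj j * T ^ 2) * (fourierCoeff 𝒞a' κ).re := by rw [eA]; ring
    · calc |(fourierCoeff 𝒞a' κ).re - (fourierCoeff 𝒞b' κ).re|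
          ≤ 2⁻¹ * (Kj j * T ^ 2) * (fourierCoeff 𝒞₁ (liftMode M r κ)).re := h₁
        _ = 2⁻¹ * (Kj j * T ^ 2) * (fourierCoeff 𝒞b' κ).re := by rw [eB]
  have hcmpa : ∀ κ : Fin d → ZMod Mb,
      |(fourierCoeff 𝒞a' κ).re - (fourierCoeff 𝒞b' κ).re| ≤ ρm κ * (fourierCoeff 𝒞a' κ).re := by
    intro κ
    by_cases hκ : κ = 0
    · rw [hκ, hfa_zero, hfb_zero, sub_self, abs_zero, hρm0, zero_mul]
    · exact (hshell κ hκ).1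
  have hcmpb : ∀ κ : Fin d → ZMod Mb,
      |(fourierCoeff 𝒞a' κ).re - (fourierCoeff 𝒞b' κ).re| ≤ ρm κ * (fourierCoeff 𝒞b' κ).re := by
    intro κ
    by_cases hκ : κ = 0
    · rw [hκ, hfa_zero, hfb_zero, sub_self, abs_zero, hρm0, zero_mul]
    · exact (hshell κ hκ).2
  -- the Hilbert–Schmidt sum over the shells of the small torus
  have hρm_shell : ∀ κ : Fin d → ZMod Mb, κ ≠ 0 →
      ∃ j, InShell L j κ ∧ |ρm κ| ≤ E * (K2 / (L : ℝ) ^ ((k + 1 - j) * (ñ - n))) := by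
    intro κ hκ
    refine ⟨Classical.choose (exists_inShell hL2 hκ), Classical.choose_spec (exists_inShell hL2 hκ), ?_⟩
    set j := Classical.choose (exists_inShell hL2 hκ) with hjdef
    rw [abs_of_nonneg (hρm_nonneg κ)]
    have hρκ : ρm κ = 2⁻¹ * (Kj j * T ^ 2) := by simp only [hρmdef, dif_neg hκ, hjdef]
    rw [hρκ, hEdef, hKjdef]
    exact le_of_eq (by ring)
  have hsum := sum_sq_le_of_shellRatio (d := d) (M := Mb) hL5 hMbdef (k := k + 1) hd1 hgap (E := E) (K := K2)
    hρm0 hρm_shell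
  set hS := Real.sqrt ((3 : ℝ) ^ (d + 1) * (L : ℝ) ^ ((Nb - (k + 1)) * d)) * (E * K2) with hhSdef
  have hhS0 : 0 ≤ hS := by positivity
  have hsum' : ∑ κ, ρm κ ^ 2 ≤ hS ^ 2 := by
    rw [hhSdef, mul_pow, Real.sq_sqrt (by positivity)]
    calc ∑ κ, ρm κ ^ 2 ≤ (3 : ℝ) ^ (d + 1) * (E * K2) ^ 2 * (L : ℝ) ^ ((Nb - (k + 1)) * d) := hsum
      _ = (3 : ℝ) ^ (d + 1) * (L : ℝ) ^ ((Nb - (k + 1)) * d) * (E * K2) ^ 2 := by ring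
  -- the localisation engine
  have hmain := tayNormLE_fluct_sub_fluct_of_sum_sq_transfer _ hB.isLocal hB.dominated hSa hSb hpq hSp hea heb
    h0a h0b hposa hpos₁ (projSite hdvd) S hea' heb' hnna' hnnb' hposa' hposb' hcova hcovb hρm_nonneg hcmpa
    hcmpb hhS0 hsum' hX _ (gauge_const _ k X) hTloc hb hFd hFloc hF
  rw [pow_rpow_inv_eq_rpow_inv_pow hA𝒫p] at hmain
  convert hmain using 1
  ring

end Package

end Literature.MathematicalPhysics.StatisticalMechanics.GradientRG

end
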